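import Literature.AlgebraicGeometry.Frobenioids.NumberFieldLocalizationsFrobeniusSlim
import Literature.AlgebraicGeometry.Frobenioids.NumberFieldLocalizationApplication
import Literature.AlgebraicGeometry.Frobenioids.NumberFieldLocalizationCategoriesFSMFF
import Mathlib.FieldTheory.Galois.Profinite
import Mathlib.RingTheory.Valuation.RamificationGroup
import HarnessLib

/-!
# Frobenioids II, Example 1.4 / Proposition 1.5 at THE printed data: `Gal(F̃/F)` with the Krull
# topology and the decomposition group of a valuation

Mochizuki, *The geometry of Frobenioids II: poly-Frobenioids*, Kyushu J. Math. **62** (2008)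
401–460, §1, Example 1.4 "Localizations of Number Fields" (i)–(iii) pp. 12–13 and Proposition 1.5
(i)–(ix) pp. 13–15 [cite: MochizukiFrdII2008, Ex. 1.4 pp.12-13] [cite: MochizukiFrdII2008, Prop. 1.5
pp.13-15].

PROOF-ONLY file (no definitions).  The statement file `NumberFieldLocalizationCategories.lean`
(abc-iut-L1-t8) renders Example 1.4 — following the author's own identification p. 62, "the category
`P₀` of Example 1.4 may be identified with the category `B(D_v)⁰`", `D_v = Gal(F̃_v/F_v) ⊆ Gal(F̃/F)` —
over an ABSTRACT topological group `G` (for `Gal(F̃/F)` with the Krull topology) and a subgroup `D`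
(for the decomposition group `D_v`), and the discharge files prove Example 1.4 (ii)/(iii) and
Proposition 1.5 for `G` PROFINITE (`[IsTopologicalGroup G] [CompactSpace G]
[TotallyDisconnectedSpace G]`), resp. for any topology where profiniteness is not needed.  This file
records, in the kernel, that THE PRINTED DATA meet those hypotheses and hence that every discharged
clause holds there verbatim: for fields `F ⊆ F̃` (`F̃/F` Galois, possibly infinite, where profiniteness is
used; in print `F` is a number field and `F̃/F` a Galois extension) take

* `G := F̃ ≃ₐ[F] F̃` — Mathlib's `Gal(F̃/F)` with its canonical KRULL topology (`krullTopology`; a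
  topological group, compact by `InfiniteGalois` (inverse limit of the finite Galois quotients), totally
  separated hence totally disconnected for `F̃/F` algebraic), and
* `D := A.decompositionSubgroup F` for a valuation subring `A` of `F̃` — Mathlib's decomposition group
  (`ValuationSubring.decompositionSubgroup` = the stabiliser of `A` in `Gal(F̃/F)`), i.e. `D_ṽ` for the
  nonarchimedean valuation `ṽ` of `F̃` with ring `A`, lying over `v := ṽ|_F`.

(The archimedean case of the printed "possibly archimedean `v`", where `D_v` has order `≤ 2`, is not a
valuation subring and is not instantiated here; nothing is claimed about it.)  All statements below are
one-line instances of the landed theorems — the content checked by the kernel is the instance chain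
`IsGalois ⇒ IsTopologicalGroup ∧ CompactSpace ∧ TotallyDisconnectedSpace` for the Krull topology
(`galois_profinite`).  The clauses whose proofs use only that the Krull topology is a GROUP topology
(everything in Example 1.4 (ii) except (arrow-wise) essential surjectivity of `E₀ → P₀`; the Prop. 1.5 (i)
base case; Prop. 1.5 (ix)) are recorded for an ARBITRARY field extension `F̃/F` (first section); the
others for `F̃/F` Galois (section `Galois`).  The classical dictionary `D_ṽ ≅ Gal(F̃_ṽ/F_v)` (as profinite
groups) is not re-proved here.  Nothing here bears on [IUTchIII]; no side is taken on its Corollary 3.12.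
-/

namespace Literature.AlgebraicGeometry.Frobenioids

open CategoryTheory

namespace NFLocCat

universe v' u' u

variable (F L : Type u) [Field F] [Field L] [Algebra F L] (A : ValuationSubring L)

/-! ### Example 1.4 (ii)/(iii) and Prop. 1.5 (ix) at `(Gal(F̃/F), D_ṽ)` — the clauses that hold for ANY
extension `F̃/F` (the Krull topology is always a group topology; `F̃/F` need not be Galois) -/

/-- FrdII Ex. 1.4 (ii) p. 13 at the printed data: "the category `E₀` is connected".
[cite: MochizukiFrdII2008, Ex. 1.4 (ii) p.13] -/
theorem galois_eConnected : EConnected (L ≃ₐ[F] L) (A.decompositionSubgroup F) :=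
  eConnected_holds _


/-- FrdII Ex. 1.4 (ii) p. 13 at the printed data: "`E₀` is … totally epimorphic".
[cite: MochizukiFrdII2008, Ex. 1.4 (ii) p.13] -/
theorem galois_eTotallyEpimorphic : ETotallyEpimorphic (L ≃ₐ[F] L) (A.decompositionSubgroup F) :=
  eTotallyEpimorphic_holds _


/-- FrdII Ex. 1.4 (ii) p. 13 at the printed data: "`E₀ → P₀` is faithful".
[cite: MochizukiFrdII2008, Ex. 1.4 (ii) p.13] -/
theorem galois_toP₀Faithful : ToP₀Faithful (L ≃ₐ[F] L) (A.decompositionSubgroup F) :=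
  toP₀Faithful_holds _


/-- FrdII Ex. 1.4 (ii) p. 13 at the printed data: the description of the FSM-morphisms of `E₀` that are
not isomorphisms (those with invertible `P`-component). [cite: MochizukiFrdII2008, Ex. 1.4 (ii) p.13] -/
theorem galois_fsmDescription : FSMDescription (L ≃ₐ[F] L) (A.decompositionSubgroup F) :=
  fsmDescription_holds _


/-- FrdII Ex. 1.4 (ii) p. 13 at the printed data: "Thus, the category `E₀` is not [in general] of
FSM-type" in its typed form (a morphism with invertible `P`-component which is not an isomorphism
witnesses the failure of FSM-type). [cite: MochizukiFrdII2008, Ex. 1.4 (ii) p.13] -/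
theorem galois_notFSMType : NotFSMType (L ≃ₐ[F] L) (A.decompositionSubgroup F) :=
  notFSMType_holds _


/-- FrdII Ex. 1.4 (ii) p. 13 at the printed data: "one verifies immediately that `E₀` is of
FSMFF-type". [cite: MochizukiFrdII2008, Ex. 1.4 (ii) p.13] -/
theorem galois_eFSMFF : EFSMFF (L ≃ₐ[F] L) (A.decompositionSubgroup F) :=
  eFSMFF_holds _


/-- FrdII Prop. 1.5 (iii) proof p. 14 at the printed data: "`P₀` [= `B(D_v)⁰`] is totally epimorphic".
[cite: MochizukiFrdII2008, Prop. 1.5 (iii) p.14] -/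
theorem galois_pTotallyEpimorphic : PTotallyEpimorphic (L ≃ₐ[F] L) (A.decompositionSubgroup F) :=
  pTotallyEpimorphic_holds _


/-- The assembly obligation `ToP₀HomReconstruction` (Prop. 1.5 (i), base case: "`P₀` is reconstructed
from `E₀` by inverting the `P₀`-isomorphisms") at the printed data.
[cite: MochizukiFrdII2008, Prop. 1.5 (i) p.14] -/
theorem galois_toP₀HomReconstruction :
    ToP₀HomReconstruction (L ≃ₐ[F] L) (A.decompositionSubgroup F) :=
  toP₀HomReconstruction_holds _ _


/-- The assembly obligation `PHasTrivialFactorizations` (Prop. 1.5 (ix): "`D_v` trivial or of prime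
order ⇒ …") at the printed data. [cite: MochizukiFrdII2008, Prop. 1.5 (ix) p.15] -/
theorem galois_pHasTrivialFactorizations :
    PHasTrivialFactorizations (L ≃ₐ[F] L) (A.decompositionSubgroup F) :=
  pHasTrivialFactorizations_holds _ _


/-- FrdII Ex. 1.4 (iii) p. 13 at the printed data (repaired, antecedent-carrying form typed by the
statement file): for a connected, totally epimorphic `P → P₀`, `E := P ×_{P₀} E₀` is connected and
totally epimorphic, of FSMFF-type if `P` is of FSM-type, slim if `P` is slim, and — under the
non-degeneracy clause — of strongly indissectible type if `P` is.
[cite: MochizukiFrdII2008, Ex. 1.4 (iii) p.13] -/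
theorem galois_applicationToPadicFrobenioidsRepaired :
    ApplicationToPadicFrobenioidsRepaired.{v', u'} (L ≃ₐ[F] L) (A.decompositionSubgroup F) :=
  applicationToPadicFrobenioidsRepaired_holds _


section AnyExtension

variable {P : Type u'} [Category.{v'} P] (Φ : P ⥤ PCat (L ≃ₐ[F] L) (A.decompositionSubgroup F))

/-- **FrdII Prop. 1.5 (ix)**, factorisation clause, p. 15 at the printed data: if `D_ṽ` is trivial or
of prime order, every factorisation `φ_P = α_P ∘ β_P` in `P` lifts to `E`.
[cite: MochizukiFrdII2008, Prop. 1.5 (ix) p.15] -/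
theorem galois_prop15_ix
    (hD : A.decompositionSubgroup F = ⊥ ∨ (Nat.card (A.decompositionSubgroup F)).Prime)
    {X Y : NFLoc.Loc Φ (toP₀ (L ≃ₐ[F] L) (A.decompositionSubgroup F))} (φ : X ⟶ Y) {M : P}
    (β : X.fst ⟶ M) (α : M ⟶ Y.fst) (hφ : β ≫ α = φ.fst) :
    ∃ (X₂ : ECat (L ≃ₐ[F] L) (A.decompositionSubgroup F))
      (γ : Φ.obj M ≅ (toP₀ (L ≃ₐ[F] L) (A.decompositionSubgroup F)).obj X₂) (βE : X ⟶ CFP.mk M X₂ γ)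
      (αE : CFP.mk M X₂ γ ⟶ Y), βE ≫ αE = φ ∧ βE.fst = β ∧ αE.fst = α :=
  prop15_ix_holds _ Φ hD φ β α hφ


end AnyExtension

/-! ### The clauses that need `Gal(F̃/F)` profinite: `F̃/F` Galois -/

section Galois

variable [IsGalois F L]

/-- `Gal(F̃/F)` with the Krull topology is a compact, totally disconnected topological group for `F̃/F`
Galois — the hypotheses under which Example 1.4 (ii)/(iii) and Proposition 1.5 were discharged.
[cite: MochizukiFrdII2008, Ex. 1.4 (i) p.12] -/
theorem galois_profinite :
    IsTopologicalGroup (L ≃ₐ[F] L) ∧ CompactSpace (L ≃ₐ[F] L) ∧ TotallyDisconnectedSpace (L ≃ₐ[F] L) :=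
  ⟨inferInstance, inferInstance, inferInstance⟩


/-- FrdII Ex. 1.4 (ii) p. 13 at the printed data: "`E₀ → P₀` is … arrow-wise essentially surjective"
(this is the clause that needs `Gal(F̃/F)` profinite). [cite: MochizukiFrdII2008, Ex. 1.4 (ii) p.13] -/
theorem galois_toP₀ArrowwiseEssSurj :
    ToP₀ArrowwiseEssSurj (L ≃ₐ[F] L) (A.decompositionSubgroup F) :=
  toP₀ArrowwiseEssSurj_holds _


/-- The assembly obligation `ToP₀EssSurj` of `NumberFieldLocalizationsGlue.lean` at the printed data:
`E₀ → P₀` is essentially surjective. [cite: MochizukiFrdII2008, Ex. 1.4 (ii) p.13] -/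
theorem galois_toP₀EssSurj : ToP₀EssSurj (L ≃ₐ[F] L) (A.decompositionSubgroup F) :=
  toP₀EssSurj_of_profinite _ _


variable {P : Type u'} [Category.{v'} P] (Φ : P ⥤ PCat (L ≃ₐ[F] L) (A.decompositionSubgroup F))

/-- FrdII Ex. 1.4 (iii) p. 13 at the printed data, the four unconditional clauses ("cf. Prop. 1.5 (ii),
(iii), (viii), (iv)") for `E := P ×_{P₀} E₀`. [cite: MochizukiFrdII2008, Ex. 1.4 (iii) p.13] -/
theorem galois_application (hPc : IsConnected P) (hPt : IsTotallyEpimorphic P) :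
    IsConnected (CFP Φ (toP₀ (L ≃ₐ[F] L) (A.decompositionSubgroup F))) ∧
      IsTotallyEpimorphic (CFP Φ (toP₀ (L ≃ₐ[F] L) (A.decompositionSubgroup F))) ∧
      (IsOfFSMType P → IsOfFSMFFType (CFP Φ (toP₀ (L ≃ₐ[F] L) (A.decompositionSubgroup F)))) ∧
      (IsSlim P → IsSlim (CFP Φ (toP₀ (L ≃ₐ[F] L) (A.decompositionSubgroup F)))) :=
  application_of_profinite _ Φ hPc hPt


/-- **FrdII Prop. 1.5 (i)** p. 13 at the printed data: `E → P` is faithful and arrow-wise essentially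
surjective, and `P` is reconstructed from `E` by inverting the `P`-isomorphisms.
[cite: MochizukiFrdII2008, Prop. 1.5 (i) p.13] -/
theorem galois_prop15_i :
    (NFLoc.toP Φ (toP₀ (L ≃ₐ[F] L) (A.decompositionSubgroup F))).Faithful ∧
      IsArrowwiseEssSurj (NFLoc.toP Φ (toP₀ (L ≃ₐ[F] L) (A.decompositionSubgroup F))) ∧
      NFLoc.HomReconstruction (NFLoc.toP Φ (toP₀ (L ≃ₐ[F] L) (A.decompositionSubgroup F))) :=
  prop15_i_holds _ Φ


/-- **FrdII Prop. 1.5 (ii)** p. 13 at the printed data: `P` is connected iff `E` is.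
[cite: MochizukiFrdII2008, Prop. 1.5 (ii) p.13] -/
theorem galois_prop15_ii :
    IsConnected P ↔ IsConnected (NFLoc.Loc Φ (toP₀ (L ≃ₐ[F] L) (A.decompositionSubgroup F))) :=
  prop15_ii_holds _ Φ


/-- **FrdII Prop. 1.5 (iii)** p. 14 at the printed data: `P` is totally epimorphic iff `E` is.
[cite: MochizukiFrdII2008, Prop. 1.5 (iii) p.14] -/
theorem galois_prop15_iii :
    IsTotallyEpimorphic P ↔
      IsTotallyEpimorphic (NFLoc.Loc Φ (toP₀ (L ≃ₐ[F] L) (A.decompositionSubgroup F))) :=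
  prop15_iii_holds _ Φ


/-- **FrdII Prop. 1.5 (iv)** p. 14 at the printed data, the clauses that are theorems of the tree: the
first bijection `Aut(P_P → P) ⥲ Aut(E_E → P)`, injectivity of `Aut(E_E → E) → Aut(E_E → P)`, "`P` slim ⇒
`E` slim", "`P` Frobenius-slim ⇒ `E` Frobenius-slim" (the remaining printed clauses are erratum
candidates, see `NumberFieldLocalizationsAut.lean`; not asserted).
[cite: MochizukiFrdII2008, Prop. 1.5 (iv) p.14] -/
theorem galois_prop15_iv :
    (∀ X : NFLoc.Loc Φ (toP₀ (L ≃ₐ[F] L) (A.decompositionSubgroup F)),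
        Function.Bijective (NFLoc.autPostToP X)) ∧
      (∀ X : NFLoc.Loc Φ (toP₀ (L ≃ₐ[F] L) (A.decompositionSubgroup F)),
        Function.Injective (NFLoc.autWhiskerToP X)) ∧
      (IsSlim P → IsSlim (NFLoc.Loc Φ (toP₀ (L ≃ₐ[F] L) (A.decompositionSubgroup F)))) ∧
      (IsFrobeniusSlim P →
        IsFrobeniusSlim (NFLoc.Loc Φ (toP₀ (L ≃ₐ[F] L) (A.decompositionSubgroup F)))) :=
  prop15_iv_holds _ Φ


/-- **FrdII Prop. 1.5 (v)** p. 14 at the printed data: a morphism of `E` is a monomorphism (resp.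
fiberwise surjective; an FSM-morphism) iff its projection to `P` is.
[cite: MochizukiFrdII2008, Prop. 1.5 (v) p.14] -/
theorem galois_prop15_v {X Y : NFLoc.Loc Φ (toP₀ (L ≃ₐ[F] L) (A.decompositionSubgroup F))}
    (φ : X ⟶ Y) :
    (Mono φ ↔ Mono φ.fst) ∧ (IsFiberwiseSurjective φ ↔ IsFiberwiseSurjective φ.fst) ∧
      (IsFSM φ ↔ IsFSM φ.fst) :=
  prop15_v_holds _ Φ φ


/-- **FrdII Prop. 1.5 (vi)** p. 14 at the printed data: if `P` is of FSM-type, a morphism of `E` is a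
`P`-isomorphism iff it is an FSM-morphism. [cite: MochizukiFrdII2008, Prop. 1.5 (vi) p.14] -/
theorem galois_prop15_vi (hP : IsOfFSMType P)
    {X Y : NFLoc.Loc Φ (toP₀ (L ≃ₐ[F] L) (A.decompositionSubgroup F))} (φ : X ⟶ Y) :
    NFLoc.IsProjIso (NFLoc.toP Φ (toP₀ (L ≃ₐ[F] L) (A.decompositionSubgroup F))) φ ↔ IsFSM φ :=
  prop15_vi_holds _ Φ hP φ


/-- **FrdII Prop. 1.5 (vii)** p. 14 at the printed data, repaired form (Ex. 1.4 (iii) last clause):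
under the non-degeneracy clause, `P` of strongly indissectible type ⇒ `E` of strongly indissectible
type. [cite: MochizukiFrdII2008, Prop. 1.5 (vii) p.14] -/
theorem galois_prop15_vii
    (hne : ∀ Y : CFP Φ (toP₀ (L ≃ₐ[F] L) (A.decompositionSubgroup F)),
      IsNonemptyObj Y ↔ IsNonemptyObj Y.fst)
    (hP : IsOfStronglyIndissectibleType P) :
    IsOfStronglyIndissectibleType (CFP Φ (toP₀ (L ≃ₐ[F] L) (A.decompositionSubgroup F))) :=
  isOfStronglyIndissectibleType_of_fst _ Φ hne hP


end Galois

end NFLocCat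

end Literature.AlgebraicGeometry.Frobenioids
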